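import Summits.AtomisticToContinuum.Crystallization.Theorems.FrustratedLawDichotomyCellT3flatClassesA
import Summits.AtomisticToContinuum.Crystallization.Theorems.FrustratedLawDichotomyCellT3flatClassesB
import Summits.AtomisticToContinuum.Crystallization.Theorems.FrustratedLawDichotomyCellT3flatClassesC
import Summits.AtomisticToContinuum.Crystallization.Theorems.FrustratedLawDichotomyCellT3flatClassesD

/-!
# FrustratedLawDichotomy · crux `AperiodicFrustratedLawGap` (stmt-AtomisticToContinuum-27623) — ★★ THE T′♭₄₅ LITERAL OF RECORD IS FALSE:
# third witness, STABLE under the exemption proxy of record (no site `NonEquilibriumCore`, float): `¬ SchurTopologicalPricing (1/20) (1/8) w₄₅ ω₄ (3/400) (−7175/10000) κ_T C_T` for every `κ_T ≥ 0.933·10⁻²`, every `C_T`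
# (decomp-a2c, prover hand 1, generation 15; critic rows 543 (B3)(2) / 555 (B) / 564 (i); axioms standard — sixteen `decide +kernel` class evaluations)

THE WITNESS (`…CellT3flatData.cellT`): an all-strained hcp 2×2×2 periodic cell found this generation by optimising the CERTIFIABLE flag directly — every site
has radial spread `r₁₂/d = 1.1254 ≥ 9/8` (so, by the rotation-free radial obstruction `…CellKitF.not_goodAt_of_radial`, it is NOT `1/8`-good and NOT
`1/20`-good for ANY isometry and ANY assignment), a clean twelve-shell, separation `≥ 0.93`, and mean priced `W₄₅` site energy `−0.7175 + 0.93232·10⁻²`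
(certified upper bound from `…CellKitW.effPot_le_ubW` termwise; num/certify-style exact mirror).  Hand-1 g14's T-ceiling was `1.3128·10⁻²` (misfit-based
adversary); the `E₂g` optical basal-slip basin found here is cheaper by `3.2·10⁻³` per site and crosses the literal `κ_T = 1/100`.
THE THEOREMS: `cellT3_checkClass`, ★ `not_schurTopologicalPricing_fourHalf_of_ge` (`933/10⁵ ≤ κ_T`, every `C_T`). PROXY-STABILITY (float, num/gain7.py; critic row 586 (2)–(3) TAG 190): max over sites of the best single-atom move gain within radius `1/20` with LJ cutoff `7` = `4.73·10⁻⁴ < 6.68·10⁻⁴` (the `MoveUnstableCore` allowance at `s = 1/20`, `Rm = 7`, `ε = 10⁻⁴`) and full site sums `≪ −0.7018` ⇒ NO site of `cellT3` is `NonEquilibriumCore (−0.7175) 10⁻⁴ 7 (1/20) 10⁻⁴`: the COLLARED T-pieces of record are numerically violated by this cell as well (their non-exempt all-bad interior is priced at `eUp + κ_T = −0.7075 > −0.70818`); the certified statement here is the unexempted one — through `…CellCheckerBad.not_schurTopologicalPricing_fourHalf_of_checkBad` and the all-bad twin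
`…PeriodicBlockViolationBad.not_schurTopologicalPricing_of_badCell` of hand-2 g15's periodic-block negative kernel.
CONSEQUENCE for the column of record: every door taking `hT : SchurTopologicalPricing (1/20) (1/8) w₄₅ ω₄ (3/400) (−7175/10000) (1/100) C_T`
(`…SchurCutB.fdg_of_split_schurCut_fourHalf'`-type kernels, `…PeriodicEnergyCeiling`, `…SchurMotifFourHalfProved`, `…OptimalityCut`, `…AveragingCut*`)
has an UNSATISFIABLE hypothesis at that literal; the T-price must be re-filed below `0.933·10⁻²` (and the true infimum over periodic all-bad cells may be lower
still — this is ONE basin of a 16-atom cell).  All `[folklore]`; 0 sorry; no `native_decide`.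
-/

namespace Summit.AtomisticToContinuum.Crystallization.Theorems.FrustratedLawDichotomyCellT3flatCeiling

open Summit.AtomisticToContinuum.Crystallization.Theorems.FrustratedLawDichotomySchurCut
open Summit.AtomisticToContinuum.Crystallization.Theorems.FrustratedLawDichotomyCellChecker

/-- All sixteen classes of `cellT3` pass `checkClassBad`. [folklore] -/
theorem cellT3_checkClass : ∀ m : Fin cellT3.N₀, cellT3.checkClassBad m (cellT3Cert m) = true := by
  intro m
  obtain ⟨m, hm⟩ := m
  have hm' : m < 16 := hm
  interval_cases m
  exacts [cellT3_checkClass0, cellT3_checkClass1, cellT3_checkClass2, cellT3_checkClass3, cellT3_checkClass4, cellT3_checkClass5, cellT3_checkClass6, cellT3_checkClass7, cellT3_checkClass8, cellT3_checkClass9, cellT3_checkClass10, cellT3_checkClass11, cellT3_checkClass12, cellT3_checkClass13, cellT3_checkClass14, cellT3_checkClass15]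

/-- ★ **T′♭₄₅ ceiling**: for every `κ_T ≥ 933/10⁵` and every `C_T`, `¬ SchurTopologicalPricing (1/20) (1/8) w₄₅ ω₄ (3/400) (−7175/10000) κ_T C_T`. [folklore] -/
theorem not_schurTopologicalPricing_fourHalf_of_ge {κT : ℝ} (hκ : (933 : ℝ) / 10 ^ 5 ≤ κT) (CT : ℝ) :
    ¬ SchurTopologicalPricing (1 / 20) (1 / 8) w₄₅ ω₄ (3 / 400) (-(7175 / 10000)) κT CT := by
  refine cellT3.not_schurTopologicalPricing_fourHalf_of_checkBad cellT3Cert cellT3_checkGeom cellT3_checkClass ?_ CT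
  have hN : ((cellT3.N₀ : ℕ) : ℝ) = 16 := by norm_num [cellT3]
  rw [hN]
  calc _ < (((16 * (-(7175 / 10000) + 933 / 10 ^ 5) : ℚ)) : ℝ) := (Rat.cast_lt (K := ℝ)).2 cellT3_total
    _ ≤ 16 * (-(7175 / 10000) + _) := by push_cast; nlinarith

end Summit.AtomisticToContinuum.Crystallization.Theorems.FrustratedLawDichotomyCellT3flatCeiling
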